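import Summits.HodgeConjecture.CorCM.IrreducibleOddWeightsMultiplicityCriterionFamilies
import HarnessLib

/-!
# The Helly number of degeneracy: a family of CM types is nondegenerate iff every sub-family of at most `q + 1`
# members is, `q = max_π d_π / δ_π`

COR-CM (cell `pub-hodgecm2`, binder seat `b16` gen 58, count-neutral claim CERTIFICATES (+ HELLY NUMBER), file F4 —
abstract `G`-set level; theorems only, no definition, no named fact, no `sorry`).  NEW as stated, hence under
`Summits/`.  HONEST FRAMING: unconditional finite-dimensional linear algebra over `ℚ` about the rank of families of CM types
(= `dim` of the Mumford–Tate group of a product of CM abelian varieties); `HC_CM` is neither used nor asserted.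

Setting of `CorCM/IrreducibleOddWeightsMultiplicityCriterionFamilies` (gen 57, F9): a group `G` permuting finite slots
`E_i` (`i ∈ I`), types `Φ_i ⊆ E_i` (CM types for a conjugation `ρ`), family type `Σ`, pairwise non-isomorphic irreducible
`ℚ`-representations `(π_k, V_k)` covering the spans `U(Φ_i)`, `d_k = dim V_k`, `δ_k = dim End_G V_k`, slot evaluation
spaces `Ev_i(π_k) ≤ V_k`.  F9 proved the finite test: `Σ` nondegenerate iff every member is AND
`dim Σ_i Ev_i(π_k) = Σ_i dim Ev_i(π_k)` for every `k`.

THE HELLY NUMBER (this file).  Let `q` bound the `D_k`-dimensions of the covering irreducibles: `d_k ≤ q · δ_k` for all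
`k` (under a Wedderburn certificate, F1, `d_k/δ_k = r_k = dim_{Z_k} V_k`).  Then

* **`typeRank_sigmaType_eq_iff_forall_card_le`**: `Σ` is nondegenerate IFF every sub-family `Σ|_T` with `|T| ≤ q + 1`
  (`T ≠ ∅`) is nondegenerate — on Hodge groups: `Hg(∏_{i∈I} A_i) = ∏ Hg(A_i)` (all of maximal rank) iff this holds for
  every product of at most `q + 1` of the factors;
* **`exists_card_le_typeRank_sigmaType_ne`**: a degenerate family contains a degenerate sub-family of `≤ q + 1` members.

PROOF.  Independence of the `Ev_i(π_k)` inside `V_k` passes to sub-families; conversely a minimal dependent set `T` of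
slot evaluation spaces in `V_k` has all its members non-zero, hence of dimension `≥ δ_k` (`δ_k ∣ dim Ev`), and `T` minus
one member is independent inside `V_k`: `(|T| − 1) δ_k ≤ d_k ≤ q δ_k`.  So `q = 1` for abelian Galois closures (the tree's
pairwise criterion `AbelianCMFamilyNondegenerate`), `q ≤ 2` when all odd irreducible constituents have `D`-dimension
`≤ 2` (e.g. dihedral, quaternion, semidihedral closures: TRIPLES decide — and pairs do not: the `SD₁₆` octics of gen 55
have all pairs additive and no additive triple).

## References

* [Mai1989] L. Mai, *Lower bounds for the ranks of CM types*, J. Number Theory 32 (1989), §2 Prop. 1.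
* [Gordon1999HodgeAVSurvey] B. B. Gordon, *A survey of the Hodge conjecture for abelian varieties*, §3, 7.5–7.7.
* [Serre1977] J.-P. Serre, *Linear Representations of Finite Groups*, GTM 42 (1977), §2.2 Prop. 4, §12.2.
-/

set_option autoImplicit false

noncomputable section

open scoped BigOperators

universe u u' v w

namespace Summit.HodgeConjecture.CorCM.IrrOdd

open Literature.NumberTheory.ComplexMultiplication

variable {G : Type w} [Group G]

/-- The evaluation space `Ev[G, π, w] = {T w : T equivariant}` (local notation, no definition). -/
local notation3 (prettyPrint := false) "Ev[" G' ", " π ", " w "]" =>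
  Submodule.span ℚ {v | ∃ T : (_ → ℚ) →ₗ[ℚ] _,
    (∀ (g : G') (f : _ → ℚ), T (fun x => f (g⁻¹ • x)) = π g (T f)) ∧ T w = v}

/-! ### §0 Independent families of subspaces: bookkeeping over finsets -/

section Subspaces

variable {I : Type u} {W : Type*} [AddCommGroup W] [Module ℚ W] [FiniteDimensional ℚ W]

/-- `dim (sup_{i∈T} S_i) ≤ Σ_{i∈T} dim S_i`. [folklore] -/
theorem finrank_finsetSup_le_sum [DecidableEq I] (S : I → Submodule ℚ W) (T : Finset I) :
    Module.finrank ℚ (T.sup S : Submodule ℚ W) ≤ ∑ i ∈ T, Module.finrank ℚ (S i) := by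
  induction T using Finset.induction_on with
  | empty => rw [Finset.sup_empty, Finset.sum_empty, finrank_bot]
  | insert a t ha ih =>
    rw [Finset.sup_insert, Finset.sum_insert ha]
    exact (Submodule.finrank_add_le_finrank_add_finrank _ _).trans (Nat.add_le_add_left ih _)

/-- **Independence passes to sub-families**: if `dim (sup_{i∈T} S_i) = Σ_{i∈T} dim S_i` and `T' ⊆ T` then
`dim (sup_{i∈T'} S_i) = Σ_{i∈T'} dim S_i`. [folklore] -/
theorem finrank_finsetSup_eq_sum_of_subset [DecidableEq I] (S : I → Submodule ℚ W) {T T' : Finset I} (hT'T : T' ⊆ T)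
    (hT : Module.finrank ℚ (T.sup S : Submodule ℚ W) = ∑ i ∈ T, Module.finrank ℚ (S i)) :
    Module.finrank ℚ (T'.sup S : Submodule ℚ W) = ∑ i ∈ T', Module.finrank ℚ (S i) := by
  have hsplit : T.sup S = T'.sup S ⊔ (T \ T').sup S := by
    rw [← Finset.sup_union, Finset.union_sdiff_of_subset hT'T]
  have hsum : ∑ i ∈ T, Module.finrank ℚ (S i) =
      ∑ i ∈ T', Module.finrank ℚ (S i) + ∑ i ∈ T \ T', Module.finrank ℚ (S i) := by
    rw [← Finset.sum_union Finset.disjoint_sdiff, Finset.union_sdiff_of_subset hT'T]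
  have h1 : Module.finrank ℚ (T.sup S : Submodule ℚ W) ≤
      Module.finrank ℚ (T'.sup S : Submodule ℚ W) + Module.finrank ℚ ((T \ T').sup S : Submodule ℚ W) := by
    rw [hsplit]
    exact Submodule.finrank_add_le_finrank_add_finrank _ _
  have h2 := finrank_finsetSup_le_sum S (T \ T')
  have h3 := finrank_finsetSup_le_sum S T'
  omega

omit [FiniteDimensional ℚ W] in
/-- The finset supremum over a subtype-indexed family is the `iSup`. [folklore] -/
theorem finsetSup_eq_iSup_subtype (S : I → Submodule ℚ W) (T : Finset I) :
    (T.sup S : Submodule ℚ W) = ⨆ j : (T : Set I), S j := by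
  apply le_antisymm
  · exact Finset.sup_le fun i hi => le_iSup (fun j : (T : Set I) => S j) ⟨i, hi⟩
  · exact iSup_le fun j => Finset.le_sup (f := S) j.2

end Subspaces

/-! ### §1 The Helly number -/

variable {I : Type u} {E : I → Type v} [∀ i, MulAction G (E i)] [Fintype I] [∀ i, Fintype (E i)]
  {K : Type u'} [Fintype K] {V : K → Type*} [∀ k, AddCommGroup (V k)] [∀ k, Module ℚ (V k)]
  [∀ k, FiniteDimensional ℚ (V k)]

/-- **THE HELLY NUMBER OF DEGENERACY.**  Pairwise non-isomorphic irreducibles `(π_k, V_k)` covering every member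
`U(Φ_i)` of a family of CM types, and `q` with `d_k ≤ q · δ_k` for all `k` (`d_k = dim V_k`, `δ_k = dim End_G V_k`; under a
Wedderburn certificate `d_k/δ_k = r_k`).  THEN: `rank(Σ) = |⊔_i E_i|/2 + 1` (the family is nondegenerate,
`Hg(∏ A_i) = ∏ Hg(A_i)` of maximal rank) IFF every NON-EMPTY SUB-FAMILY WITH AT MOST `q + 1` MEMBERS is nondegenerate.
(⟸: a minimal dependent set of slot evaluation spaces `Ev_i(π_k) ≤ V_k` consists of non-zero spaces, each of dimension
`≥ δ_k`, independent after removing one member: `(|T| − 1) δ_k ≤ d_k ≤ q δ_k`.)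
[cite: Mai1989, §2 Prop. 1 (proof)] [cite: Gordon1999HodgeAVSurvey, §3 and 7.5–7.7] -/
theorem typeRank_sigmaType_eq_iff_forall_card_le [∀ i, Nonempty (E i)] [Nonempty I] {ρ : G}
    {Φ : ∀ i, Set (E i)} (h : ∀ i, IsCMTypeWith ρ (Φ i)) (π : ∀ k, Representation ℚ G (V k))
    (hirr : ∀ k, (π k).IsIrreducible) (hne : ∀ k l, k ≠ l → ∀ S : (π k).IntertwiningMap (π l), S = 0)
    (hcov : ∀ (i : I) (P : Submodule ℚ (E i → ℚ)), P ≤ antiSpan G (Φ i) → P ≠ ⊥ →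
      (∀ (g : G) (a : E i → ℚ), a ∈ P → (fun s => a (g • s)) ∈ P) →
      ∃ k, ∃ T : (E i → ℚ) →ₗ[ℚ] V k,
        (∀ (g : G) (a : E i → ℚ), T (fun s => a (g⁻¹ • s)) = π k g (T a)) ∧ ∃ a ∈ P, T a ≠ 0)
    (q : ℕ) (hq : ∀ k, Module.finrank ℚ (V k) ≤ q * Module.finrank ℚ ((π k).IntertwiningMap (π k))) :
    typeRank G (sigmaType Φ) = Fintype.card (Σ i, E i) / 2 + 1 ↔
      ∀ T : Finset I, T.Nonempty → T.card ≤ q + 1 →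
        typeRank G (sigmaType fun j : (T : Set I) => Φ j) = Fintype.card (Σ j : (T : Set I), E j) / 2 + 1 := by
  classical
  obtain ⟨i₀⟩ := ‹Nonempty I›
  haveI : Nonempty (Σ i, E i) := ⟨⟨i₀, Classical.arbitrary _⟩⟩
  -- F9 for the family and for every non-empty sub-family
  have hF := typeRank_sigmaType_eq_iff_forall_and h π hirr hne hcov
  have hFT : ∀ T : Finset I, T.Nonempty →
      (typeRank G (sigmaType fun j : (T : Set I) => Φ j) = Fintype.card (Σ j : (T : Set I), E j) / 2 + 1 ↔
        (∀ j : (T : Set I), typeRank G (Φ j) = Fintype.card (E j) / 2 + 1) ∧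
          ∀ k, Module.finrank ℚ (⨆ j : (T : Set I), Ev[G, π k, antiVec (Φ j) (1 : G)] : Submodule ℚ (V k)) =
            ∑ j : (T : Set I), Module.finrank ℚ Ev[G, π k, antiVec (Φ j) (1 : G)]) := by
    intro T hT
    obtain ⟨i₁, hi₁⟩ := hT
    haveI : Nonempty (Σ j : (T : Set I), E j) := ⟨⟨⟨i₁, hi₁⟩, Classical.arbitrary _⟩⟩
    exact typeRank_sigmaType_eq_iff_forall_and (E := fun j : (T : Set I) => E j) (fun j => h j) π hirr hne
      fun j => hcov j
  -- the slot evaluation spaces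
  set S : ∀ k, I → Submodule ℚ (V k) := fun k i => Ev[G, π k, antiVec (Φ i) (1 : G)] with hS
  have hδpos : ∀ k, 0 < Module.finrank ℚ ((π k).IntertwiningMap (π k)) := fun k =>
    finrank_intertwiningMap_pos (π k) (hirr k)
  have hdvd : ∀ k i, Module.finrank ℚ ((π k).IntertwiningMap (π k)) ∣ Module.finrank ℚ (S k i) := fun k i =>
    (finrank_antiSpan_eq_sum (Φ i) π hirr hne (hcov i)).1 k
  -- translation between the subtype-indexed and the finset-indexed forms
  have hsupT : ∀ (k) (T : Finset I), (⨆ j : (T : Set I), S k j : Submodule ℚ (V k)) = T.sup (S k) := fun k T =>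
    (finsetSup_eq_iSup_subtype (S k) T).symm
  have hsumT : ∀ (k) (T : Finset I), ∑ j : (T : Set I), Module.finrank ℚ (S k j) =
      ∑ i ∈ T, Module.finrank ℚ (S k i) := fun k T => Finset.sum_coe_sort T fun i => Module.finrank ℚ (S k i)
  have hsupU : ∀ k, (⨆ i, S k i : Submodule ℚ (V k)) = Finset.univ.sup (S k) := fun k =>
    (Finset.sup_univ_eq_iSup (S k)).symm
  constructor
  · -- ⟹: members stay nondegenerate, independence passes to sub-families
    intro hnd T hT _
    obtain ⟨hmem, hind⟩ := hF.1 hnd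
    refine (hFT T hT).2 ⟨fun j => hmem j, fun k => ?_⟩
    change Module.finrank ℚ (⨆ j : (T : Set I), S k j : Submodule ℚ (V k)) = ∑ j : (T : Set I), Module.finrank ℚ (S k j)
    rw [hsupT, hsumT]
    refine finrank_finsetSup_eq_sum_of_subset (S k) (Finset.subset_univ T) ?_
    rw [← hsupU]
    exact hind k
  · -- ⟸: a minimal dependent finset of slot evaluation spaces has at most `q + 1` elements
    intro hsub
    refine hF.2 ⟨fun i => ?_, fun k => ?_⟩
    · -- members: the singleton sub-families
      have h1 := (hFT {i} (Finset.singleton_nonempty i)).1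
        (hsub {i} (Finset.singleton_nonempty i) (by rw [Finset.card_singleton]; omega))
      exact h1.1 ⟨i, Finset.mem_singleton_self i⟩
    · change Module.finrank ℚ (⨆ i, S k i : Submodule ℚ (V k)) = ∑ i, Module.finrank ℚ (S k i)
      rw [hsupU]
      by_contra hbad
      -- a dependent finset of minimal cardinality
      have hex : ∃ n, ∃ T : Finset I, T.card = n ∧
          Module.finrank ℚ (T.sup (S k) : Submodule ℚ (V k)) ≠ ∑ i ∈ T, Module.finrank ℚ (S k i) :=
        ⟨_, Finset.univ, rfl, hbad⟩
      obtain ⟨T, hTn, hT⟩ := Nat.find_spec hex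
      have hmin : ∀ T' : Finset I, T'.card < T.card →
          Module.finrank ℚ (T'.sup (S k) : Submodule ℚ (V k)) = ∑ i ∈ T', Module.finrank ℚ (S k i) := by
        intro T' hT'
        by_contra hT'bad
        exact Nat.find_min hex (hTn ▸ hT') ⟨T', rfl, hT'bad⟩
      -- `T` is non-empty
      have hTne : T.Nonempty := by
        rw [Finset.nonempty_iff_ne_empty]
        rintro rfl
        exact hT (by rw [Finset.sup_empty, Finset.sum_empty, finrank_bot])
      -- every member of `T` has a non-zero evaluation space
      have hne0 : ∀ i ∈ T, S k i ≠ ⊥ := by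
        intro i hi h0
        have h' := hmin (T.erase i) (Finset.card_erase_lt_of_mem hi)
        apply hT
        rw [← Finset.insert_erase hi, Finset.sup_insert, Finset.sum_insert (Finset.notMem_erase i T), h0, bot_sup_eq,
          finrank_bot, zero_add, h']
      -- `T` minus one member is independent inside `V k`: `(|T| − 1) δ_k ≤ d_k ≤ q δ_k`
      have hcard : T.card ≤ q + 1 := by
        obtain ⟨i₁, hi₁⟩ := hTne
        have h' := hmin (T.erase i₁) (Finset.card_erase_lt_of_mem hi₁)
        have hge : (T.erase i₁).card * Module.finrank ℚ ((π k).IntertwiningMap (π k)) ≤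
            ∑ i ∈ T.erase i₁, Module.finrank ℚ (S k i) := by
          rw [Finset.card_eq_sum_ones, Finset.sum_mul]
          refine Finset.sum_le_sum fun i hi => ?_
          rw [one_mul]
          have hi' : i ∈ T := Finset.mem_of_mem_erase hi
          exact Nat.le_of_dvd (Nat.pos_of_ne_zero fun h0 => hne0 i hi' (Submodule.finrank_eq_zero.1 h0)) (hdvd k i)
        have hle : ∑ i ∈ T.erase i₁, Module.finrank ℚ (S k i) ≤ q * Module.finrank ℚ ((π k).IntertwiningMap (π k)) :=
          (h' ▸ Submodule.finrank_le _).trans (hq k)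
        have hcard' : (T.erase i₁).card ≤ q := Nat.le_of_mul_le_mul_right (hge.trans hle) (hδpos k)
        rw [Finset.card_erase_of_mem hi₁] at hcard'
        omega
      -- but the sub-family `T` is nondegenerate by hypothesis: contradiction
      have hgood := ((hFT T hTne).1 (hsub T hTne hcard)).2 k
      change Module.finrank ℚ (⨆ j : (T : Set I), S k j : Submodule ℚ (V k)) =
        ∑ j : (T : Set I), Module.finrank ℚ (S k j) at hgood
      rw [hsupT, hsumT] at hgood
      exact hT hgood

/-- **A degenerate family contains a degenerate sub-family of at most `q + 1` members** (the contrapositive reading of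
`typeRank_sigmaType_eq_iff_forall_card_le`): degeneracy of `Hg(∏_i A_i)` is witnessed on a product of `≤ q + 1` factors,
`q = max_k d_k/δ_k` over the covering irreducibles. [cite: Mai1989, §2 Prop. 1 (proof)] [cite: Gordon1999HodgeAVSurvey, 7.5–7.7] -/
theorem exists_card_le_typeRank_sigmaType_ne [∀ i, Nonempty (E i)] [Nonempty I] {ρ : G}
    {Φ : ∀ i, Set (E i)} (h : ∀ i, IsCMTypeWith ρ (Φ i)) (π : ∀ k, Representation ℚ G (V k))
    (hirr : ∀ k, (π k).IsIrreducible) (hne : ∀ k l, k ≠ l → ∀ S : (π k).IntertwiningMap (π l), S = 0)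
    (hcov : ∀ (i : I) (P : Submodule ℚ (E i → ℚ)), P ≤ antiSpan G (Φ i) → P ≠ ⊥ →
      (∀ (g : G) (a : E i → ℚ), a ∈ P → (fun s => a (g • s)) ∈ P) →
      ∃ k, ∃ T : (E i → ℚ) →ₗ[ℚ] V k,
        (∀ (g : G) (a : E i → ℚ), T (fun s => a (g⁻¹ • s)) = π k g (T a)) ∧ ∃ a ∈ P, T a ≠ 0)
    (q : ℕ) (hq : ∀ k, Module.finrank ℚ (V k) ≤ q * Module.finrank ℚ ((π k).IntertwiningMap (π k)))
    (hdeg : typeRank G (sigmaType Φ) ≠ Fintype.card (Σ i, E i) / 2 + 1) :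
    ∃ T : Finset I, T.Nonempty ∧ T.card ≤ q + 1 ∧
      typeRank G (sigmaType fun j : (T : Set I) => Φ j) ≠ Fintype.card (Σ j : (T : Set I), E j) / 2 + 1 := by
  by_contra hall
  push Not at hall
  exact hdeg ((typeRank_sigmaType_eq_iff_forall_card_le h π hirr hne hcov q hq).2 fun T hT hTc => hall T hT hTc)

/-- **`q = 1`: PAIRS DECIDE** when every covering irreducible is a division algebra over its commutant (`d_k = δ_k`, e.g.
all irreducible `ℚ`-representations of an ABELIAN group): the family is nondegenerate iff every sub-family of at most two
members is. [cite: Gordon1999HodgeAVSurvey, 7.5–7.7] [cite: Mai1989, §2 Prop. 1 (proof)] -/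
theorem typeRank_sigmaType_eq_iff_forall_card_le_two [∀ i, Nonempty (E i)] [Nonempty I] {ρ : G}
    {Φ : ∀ i, Set (E i)} (h : ∀ i, IsCMTypeWith ρ (Φ i)) (π : ∀ k, Representation ℚ G (V k))
    (hirr : ∀ k, (π k).IsIrreducible) (hne : ∀ k l, k ≠ l → ∀ S : (π k).IntertwiningMap (π l), S = 0)
    (hcov : ∀ (i : I) (P : Submodule ℚ (E i → ℚ)), P ≤ antiSpan G (Φ i) → P ≠ ⊥ →
      (∀ (g : G) (a : E i → ℚ), a ∈ P → (fun s => a (g • s)) ∈ P) →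
      ∃ k, ∃ T : (E i → ℚ) →ₗ[ℚ] V k,
        (∀ (g : G) (a : E i → ℚ), T (fun s => a (g⁻¹ • s)) = π k g (T a)) ∧ ∃ a ∈ P, T a ≠ 0)
    (hq : ∀ k, Module.finrank ℚ (V k) = Module.finrank ℚ ((π k).IntertwiningMap (π k))) :
    typeRank G (sigmaType Φ) = Fintype.card (Σ i, E i) / 2 + 1 ↔
      ∀ T : Finset I, T.Nonempty → T.card ≤ 2 →
        typeRank G (sigmaType fun j : (T : Set I) => Φ j) = Fintype.card (Σ j : (T : Set I), E j) / 2 + 1 :=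
  typeRank_sigmaType_eq_iff_forall_card_le h π hirr hne hcov 1 fun k => by rw [one_mul, hq k]

end Summit.HodgeConjecture.CorCM.IrrOdd

end
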